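import Literature.NumberTheory.PAdicHodge.TateGradedComparison
import Literature.NumberTheory.PAdicHodge.BdRPeriodRingData
import HarnessLib

/-!
# The filtered comparison isomorphism for de Rham representations (`B_dR(F)` is Tate-graded)

Topic `Literature/NumberTheory/PAdicHodge`; THEOREMS ONLY (no definition, no named fact, no instance,
no `sorry`). Sequel to `TateGradedFiltration` / `TateGradedInjectivity` / `TateGradedComparison`
(abstract) and `BdRPeriodRingData` (Fontaine's `B_dR(F)` as the tree's period-ring datum
`bdRPeriodRingData hp`, `F` a `p`-adic field).

## Source formalised

N. Wach, *Représentations p-adiques potentiellement cristallines*, Bull. Soc. Math. France 124 (1996),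
§B.2.3, proof of Prop. 2 (p. 394): « L'espace `D = Hom_{ℚ_p[G]}(V, B_dR)` est un `K`-espace vectoriel de
dimension finie `d` muni d'une filtration décroissante et l'application naturelle
`B_dR ⊗_K D → Hom_{ℚ_p}(V, B_dR)` est un isomorphisme de `B_dR`-modules filtrés. Soit `(u_1, …, u_d)` une
base de `D` adaptée à la filtration […] alors `Fil^n D = ⊕_{r_i ≥ n} K u_i`. On voit que
`Hom_{ℚ_p}(V, B_dR⁺)` est le `B_dR⁺`-module libre de base les `t^{-r_i} u_i` ». Read covariantly for the
tree's `B_dR(F) ⊗_{ℚ_p} V` (`= Hom(V^*, B_dR)`).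

## Contents

§1 **`B_dR(F)` is Tate-graded**: the six hypotheses of the abstract files hold for
`𝔅 = bdRPeriodRingData hp`, `U = u = [ε] − 1` (tree `uBdR`, a uniformizer of the complete DVR `B_dR⁺(F)`:
`u = ξ · unit`, `exists_uBdR_eq_xiBdR_mul`) and `χ(σ) =` the cyclotomic character of `σ` read in `F`:
`mem_fil_succ_iff` (`Fil^{i+1} = u · Fil^i`), `exists_smul_unif` (`σ u = k_σ u`, `θ(k_σ) = χ(σ)`:
`exists_galBdRPlus_uBdR_eq_mul_cyclotomic`), `cyclotomic_ne_zero`, `exists_inv_of_not_mem_fil_one`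
(`B_dR⁺` is local with maximal ideal `Fil¹ = ker θ`), `exists_sub_algebraMap_mem_fil_one` (Ax–Sen–Tate
`ℂ_F^{Γ_F} = F`, tree `CompletedAlgClosure.fixedPoints_eq_range_algebraMap`, through `θ`),
`mem_fil_one_of_forall_twist` (Tate `ℂ_F(χ^j)^{Γ_F} = 0`, `j ≠ 0`, tree
`CompletedAlgClosure.eq_zero_of_forall_smul_eq_cyclotomicCharacter_zpow`, through `θ`).
§2 **`exists_basis_mem_filTensor_iff_of_isDeRham`** — for every finite-dimensional DE RHAM `ρ` (any
`ℚ_p`-algebra structure on `F`): a `B_dR`-basis `(e_k)_{k<d}` of `B_dR ⊗_{ℚ_p} V` consisting of vectors of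
`D_dR(V)`, with weights `w_k` (`e_k ∈ Fil^{w_k}`), such that **`x ∈ Fil^n(B_dR ⊗ V) ↔ ∀ k, coordₖ(x) ∈
Fil^{n − w_k} B_dR`** for all `n`, i.e. `Fil^n(B_dR ⊗ V) = ⊕_k t^{n − w_k} B_dR⁺ · e_k` — Wach's statement;
brick (b8) of the programme towards Kato, LNM 1553, II Prop. 1.2.3 (`hasDualExp_of_isDeRham`).

BSD is not proved by any of this.

## References
* N. Wach, Bull. Soc. Math. France 124 (1996), §B.2.3, Prop. 2 and proof (p. 394). [Wach1996]
* J.-M. Fontaine, *Le corps des périodes p-adiques*; *Représentations p-adiques semi-stables*, Astérisque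
  223 (1994), Exp. II §1.5.5 (`Fil^i B_dR = t^i B_dR⁺`, `θ`), Exp. III Thm. 1.5.2. [FontaineAsterisque223III]
* J. Tate, *p-divisible groups* (1967), §3.3 Thms. 1–2 (`H⁰` halves). [Tate1967]
* K. Kato, *Lectures on the approach to Iwasawa theory for Hasse–Weil L-functions via B_dR, I*, LNM 1553
  (1993), Ch. II §1.2.6 (« the isomorphism preserving filtrations `V ⊗ B_dR ≅ D_dR(V) ⊗_K B_dR` (1.1.3) »).
  [Kato1993LNM1553]
-/

noncomputable section

open scoped TensorProduct
open ValuativeRel Field Ideal WittVector UniformSpace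
open Literature.AlgebraicGeometry.Resolution

namespace Literature.NumberTheory.PAdicHodge

open Literature.NumberTheory.GaloisRepresentations
open Literature.NumberTheory.GaloisRepresentations.IsNonarchimedeanLocalField

variable {F : Type} [Field F] [ValuativeRel F] [TopologicalSpace F] [IsNonarchimedeanLocalField F]
  [CharZero F] {p : ℕ} [Fact p.Prime] [Fact (¬ IsUnit (p : integerC F))]
  [IsAdicComplete (Ideal.span {(p : integerC F)}) (integerC F)]
  (hp : valuation F p < 1) (hF : Function.Surjective (fontaineTheta (integerC F) p))
  [IsDomain (BDeRhamPlus (integerC F) p)]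

/-! ## §1 `B_dR(F)` is Tate-graded -/

namespace BdRTateGraded

/-- An element of `B_dR⁺` whose image lies in `Fil¹ B_dR = ξ B_dR⁺` lies in `ξ B_dR⁺ = ker θ`.
[cite: FontaineAsterisque223III, Exp. II §1.5.5 (Fil¹ B_dR = ξ B_dR⁺ = ker θ)] -/
theorem mem_span_of_algebraMap_mem_fil_one {z : BDeRhamPlus (integerC F) p}
    (hz : letI := fracAlgebra (p := p) hp hF;
      algebraMap (BDeRhamPlus (integerC F) p) (FracBdR F p) z ∈ fil hp hF 1) :
    z ∈ Ideal.span {(xiBdR : BDeRhamPlus (integerC F) p)} := by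
  obtain ⟨c, hc⟩ := (mem_fil_iff hp hF).1 hz
  rw [zpow_one, ← map_mul] at hc
  rw [algebraMap_fracBdR_injective hc]
  exact Ideal.mem_span_singleton'.2 ⟨c, mul_comm c _⟩

/-- Conversely `ξ B_dR⁺ ⊆ Fil¹`. [cite: FontaineAsterisque223III, Exp. II §1.5.5 (Fil¹ B_dR = ξ B_dR⁺)] -/
theorem algebraMap_mem_fil_one_of_mem_span {z : BDeRhamPlus (integerC F) p}
    (hz : z ∈ Ideal.span {(xiBdR : BDeRhamPlus (integerC F) p)}) :
    letI := fracAlgebra (p := p) hp hF;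
      algebraMap (BDeRhamPlus (integerC F) p) (FracBdR F p) z ∈ fil hp hF 1 := by
  obtain ⟨c, rfl⟩ := Ideal.mem_span_singleton'.1 hz
  exact (mem_fil_iff hp hF).2 ⟨c, by rw [zpow_one, map_mul, mul_comm]⟩

/-- `Fil⁰ B_dR = B_dR⁺` (the image of `algebraMap`). [cite: FontaineAsterisque223III, Exp. II §1.5.5 (Fil⁰ B_dR = B_dR⁺)] -/
theorem exists_eq_algebraMap_of_mem_fil_zero {x : FracBdR F p}
    (hx : letI := fracAlgebra (p := p) hp hF; x ∈ fil hp hF 0) :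
    ∃ b : BDeRhamPlus (integerC F) p, x = algebraMap (BDeRhamPlus (integerC F) p) (FracBdR F p) b := by
  obtain ⟨b, hb⟩ := (mem_fil_iff hp hF).1 hx
  exact ⟨b, by rw [hb, zpow_zero, one_mul]⟩

/-- **(hU) `Fil^{i+1} B_dR = u · Fil^i B_dR`** for the uniformizer `u = [ε] − 1 = ξ · v`, `v ∈ (B_dR⁺)ˣ`.
[cite: FontaineAsterisque223III, Exp. II §1.5.5 (Fil^i B_dR = t^i B_dR⁺ for any uniformizer t)] -/
theorem mem_fil_succ_iff (i : ℤ) (x : FracBdR F p) :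
    (letI := fracAlgebra (p := p) hp hF; x ∈ fil hp hF (i + 1)) ↔
      ∃ y, (letI := fracAlgebra (p := p) hp hF; y ∈ fil hp hF i) ∧
        x = algebraMap (BDeRhamPlus (integerC F) p) (FracBdR F p) uBdR * y := by
  obtain ⟨v, hv, huv⟩ := exists_uBdR_eq_xiBdR_mul (F := F) (p := p) hF
  have hΞ : algebraMap (BDeRhamPlus (integerC F) p) (FracBdR F p) xiBdR ≠ 0 := algebraMap_xiBdR_ne_zero hF
  constructor
  · intro hx
    obtain ⟨b, rfl⟩ := (mem_fil_iff hp hF).1 hx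
    refine ⟨algebraMap _ (FracBdR F p) xiBdR ^ i *
        algebraMap _ (FracBdR F p) (((hv.unit⁻¹ : (BDeRhamPlus (integerC F) p)ˣ) : BDeRhamPlus (integerC F) p) * b),
      (mem_fil_iff hp hF).2 ⟨_, rfl⟩, ?_⟩
    rw [huv, map_mul, map_mul, algebraMap_units_inv, IsUnit.unit_spec, zpow_add_one₀ hΞ]
    have hv0 : algebraMap (BDeRhamPlus (integerC F) p) (FracBdR F p) v ≠ 0 :=
      (map_ne_zero_iff _ algebraMap_fracBdR_injective).2 hv.ne_zero
    field_simp
  · rintro ⟨y, hy, rfl⟩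
    obtain ⟨b, rfl⟩ := (mem_fil_iff hp hF).1 hy
    refine (mem_fil_iff hp hF).2 ⟨v * b, ?_⟩
    rw [huv, map_mul, map_mul, zpow_add_one₀ hΞ]
    ring

/-- **(hχ) `σ(u) = k_σ · u` with `k_σ ∈ B_dR⁺` and `k_σ ≡ χ(σ) (mod Fil¹)`** (`θ(k_σ) = χ(σ)`; the scalar
`χ(σ) ∈ F` enters `B_dR` through `F ↪ B_dR⁺`). [cite: FontaineAsterisque223III, Exp. II §1.5.4–1.5.5 (g(t) = χ(g) t)] -/
theorem exists_smul_unif (σ : absoluteGaloisGroup F) :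
    ∃ k : FracBdR F p, (letI := fracAlgebra (p := p) hp hF; k ∈ fil hp hF 0) ∧
      σ • algebraMap (BDeRhamPlus (integerC F) p) (FracBdR F p) uBdR =
        k * algebraMap (BDeRhamPlus (integerC F) p) (FracBdR F p) uBdR ∧
      (letI := fracAlgebra (p := p) hp hF;
        k - algebraMap F (FracBdR F p) (LocalField.padicRingHom F p hp
          (((GaloisRep.cyclotomicCharacter F p σ : ℤ_[p]ˣ) : ℤ_[p]) : ℚ_[p])) ∈ fil hp hF 1) := by
  letI := fracAlgebra (p := p) hp hF
  obtain ⟨k, hk, hθk⟩ := exists_galBdRPlus_uBdR_eq_mul_cyclotomic hp hF σ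
  refine ⟨algebraMap _ (FracBdR F p) k, algebraMap_mem_fil_zero hp hF k, ?_, ?_⟩
  · rw [smul_algebraMap_fracBdR, hk, map_mul]
  · rw [algebraMap_fracAlgebra, ← map_sub]
    refine algebraMap_mem_fil_one_of_mem_span hp hF ((mem_ker_thetaBdR_iff _).1 ?_)
    rw [map_sub, hθk, thetaBdR_embBdRHom, sub_self]

omit hF [IsDomain (BDeRhamPlus (integerC F) p)] [Fact (¬ IsUnit (p : integerC F))]
  [IsAdicComplete (Ideal.span {(p : integerC F)}) (integerC F)] in
/-- **(hχ0)** the cyclotomic character is nonzero in `F`. [cite: Tate1967, §3.3 (χ : Γ_F → ℤ_pˣ)] -/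
theorem cyclotomic_ne_zero (σ : absoluteGaloisGroup F) :
    LocalField.padicRingHom F p hp (((GaloisRep.cyclotomicCharacter F p σ : ℤ_[p]ˣ) : ℤ_[p]) : ℚ_[p]) ≠ 0 := by
  rw [map_ne_zero_iff _ (LocalField.padicRingHom F p hp).injective]
  exact PadicInt.coe_ne_zero.2 (GaloisRep.cyclotomicCharacter F p σ).ne_zero

/-- **(hloc) `B_dR⁺` is local with maximal ideal `Fil¹ = ker θ`**: an element of `Fil⁰ ∖ Fil¹` is a unit of
`B_dR⁺`. [cite: FontaineAsterisque223III, Exp. II §1.5.5 (B_dR⁺ a complete DVR with maximal ideal ker θ)] -/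
theorem exists_inv_of_not_mem_fil_one {b : FracBdR F p}
    (hb : letI := fracAlgebra (p := p) hp hF; b ∈ fil hp hF 0)
    (hb1 : letI := fracAlgebra (p := p) hp hF; b ∉ fil hp hF 1) :
    ∃ b' : FracBdR F p, (letI := fracAlgebra (p := p) hp hF; b' ∈ fil hp hF 0) ∧ b * b' = 1 := by
  obtain ⟨b₀, rfl⟩ := exists_eq_algebraMap_of_mem_fil_zero hp hF hb
  have hθ : thetaBdR b₀ ≠ 0 := fun h =>
    hb1 (algebraMap_mem_fil_one_of_mem_span hp hF ((mem_ker_thetaBdR_iff _).1 h))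
  have hu : IsUnit b₀ := (isUnit_iff_thetaBdR_ne_zero hF _).2 hθ
  refine ⟨algebraMap _ (FracBdR F p) ((hu.unit⁻¹ : (BDeRhamPlus (integerC F) p)ˣ) : BDeRhamPlus (integerC F) p),
    algebraMap_mem_fil_zero hp hF _, ?_⟩
  rw [← map_mul, IsUnit.mul_val_inv, map_one]

/-- **(hT0) `gr⁰`-invariants are scalars: Ax–Sen–Tate `ℂ_F^{Γ_F} = F` through `θ`.** If `b ∈ B_dR⁺` and
`σ b ≡ b (mod Fil¹)` for all `σ`, then `b ≡ e (mod Fil¹)` for some `e ∈ F`.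
[cite: Tate1967, §3.3 Theorem 1 (H⁰: ℂ^{Γ_F} = F)] [cite: FontaineAsterisque223III, Exp. II §1.5.5 (θ)] -/
theorem exists_sub_algebraMap_mem_fil_one {b : FracBdR F p}
    (hb : letI := fracAlgebra (p := p) hp hF; b ∈ fil hp hF 0)
    (hσ : ∀ σ : absoluteGaloisGroup F, letI := fracAlgebra (p := p) hp hF; σ • b - b ∈ fil hp hF 1) :
    ∃ e : F, letI := fracAlgebra (p := p) hp hF; b - algebraMap F (FracBdR F p) e ∈ fil hp hF 1 := by
  letI := fracAlgebra (p := p) hp hF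
  obtain ⟨b₀, rfl⟩ := exists_eq_algebraMap_of_mem_fil_zero hp hF hb
  have hfix : ∀ σ : absoluteGaloisGroup F, σ • thetaBdR b₀ = thetaBdR b₀ := by
    intro σ
    have h := hσ σ
    rw [smul_algebraMap_fracBdR, ← map_sub] at h
    have h2 := (mem_ker_thetaBdR_iff _).2 (mem_span_of_algebraMap_mem_fil_one hp hF h)
    rwa [map_sub, thetaBdR_galBdRPlus, sub_eq_zero] at h2
  have hmem : thetaBdR b₀ ∈ {x : CompletedAlgClosure F | ∀ σ : absoluteGaloisGroup F, σ • x = x} := hfix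
  rw [CompletedAlgClosure.fixedPoints_eq_range_algebraMap] at hmem
  obtain ⟨e, he⟩ := hmem
  refine ⟨e, ?_⟩
  rw [algebraMap_fracAlgebra, ← map_sub]
  refine algebraMap_mem_fil_one_of_mem_span hp hF ((mem_ker_thetaBdR_iff _).1 ?_)
  rw [map_sub, thetaBdR_embBdRHom, he, sub_self]

/-- **(hT1) twisted `gr⁰`-invariants vanish: Tate `ℂ_F(χ^j)^{Γ_F} = 0` (`j ≠ 0`) through `θ`.** If
`b ∈ B_dR⁺` and `σ b ≡ χ(σ)^j b (mod Fil¹)` for all `σ`, `j ≠ 0`, then `b ∈ Fil¹`.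
[cite: Tate1967, §3.3 Theorem 2 (H⁰: ℂ(χ^j)^{Γ_F} = 0)] [cite: FontaineAsterisque223III, Exp. II §1.5.5 (θ)] -/
theorem mem_fil_one_of_forall_twist {j : ℤ} (hj : j ≠ 0) {b : FracBdR F p}
    (hb : letI := fracAlgebra (p := p) hp hF; b ∈ fil hp hF 0)
    (hσ : ∀ σ : absoluteGaloisGroup F, letI := fracAlgebra (p := p) hp hF;
      σ • b - algebraMap F (FracBdR F p) (LocalField.padicRingHom F p hp
        (((GaloisRep.cyclotomicCharacter F p σ : ℤ_[p]ˣ) : ℤ_[p]) : ℚ_[p]) ^ j) * b ∈ fil hp hF 1) :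
    letI := fracAlgebra (p := p) hp hF; b ∈ fil hp hF 1 := by
  letI := fracAlgebra (p := p) hp hF
  obtain ⟨b₀, rfl⟩ := exists_eq_algebraMap_of_mem_fil_zero hp hF hb
  have key : ∀ σ : absoluteGaloisGroup F, σ • thetaBdR b₀ =
      (algebraMap F (CompletedAlgClosure F)
        (LocalField.padicRingHom F p hp
          (((GaloisRep.cyclotomicCharacter F p σ : ℤ_[p]ˣ) : ℤ_[p]) : ℚ_[p]))) ^ j * thetaBdR b₀ := by
    intro σ
    have h := hσ σ
    rw [smul_algebraMap_fracBdR, algebraMap_fracAlgebra, ← map_mul, ← map_sub] at h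
    have h2 := (mem_ker_thetaBdR_iff _).2 (mem_span_of_algebraMap_mem_fil_one hp hF h)
    rw [map_sub, map_mul, thetaBdR_galBdRPlus, thetaBdR_embBdRHom, sub_eq_zero, map_zpow₀] at h2
    exact h2
  have h0 := CompletedAlgClosure.eq_zero_of_forall_smul_eq_cyclotomicCharacter_zpow hp hj key
  exact algebraMap_mem_fil_one_of_mem_span hp hF ((mem_ker_thetaBdR_iff _).1 h0)

end BdRTateGraded

/-! ## §2 The filtered comparison for de Rham representations -/

-- Mathlib's own global value; needed for instance problems on `𝔅.B ⊗[P] M` (see `PAdicHodgeProofs`).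
set_option maxSynthPendingDepth 3 in
omit hF [IsDomain (BDeRhamPlus (integerC F) p)] in
/-- **The filtered comparison isomorphism for de Rham representations** (Wach 1996, §B.2.3, proof of
Prop. 2: « `B_dR ⊗_K D → Hom_{ℚ_p}(V, B_dR)` est un isomorphisme de `B_dR`-modules filtrés. Soit `(u_i)` une
base de `D` adaptée à la filtration […] `Hom_{ℚ_p}(V, B_dR⁺)` est le `B_dR⁺`-module libre de base les
`t^{-r_i} u_i` »). For a `p`-adic field `F` (any `ℚ_p`-algebra structure) and a finite-dimensional de Rham
representation `V` of `Γ_F` (`IsDeRham` for the tree's `bdRPeriodRingData hp`), there are a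
`B_dR`-basis `(e_k)_{k<d}` of `B_dR ⊗_{ℚ_p} V` made of vectors of `D_dR(V)` — an `F`-basis of `D_dR(V)`
adapted to the Hodge filtration — and weights `w_k` with `e_k ∈ Fil^{w_k}(B_dR ⊗ V)`, such that for all
`n` and `x`: **`x ∈ Fil^n(B_dR ⊗ V) ↔ ∀ k, coordₖ(x) ∈ Fil^{n − w_k} B_dR`** — i.e.
`Fil^n(B_dR ⊗ V) = ⊕_k t^{n−w_k} B_dR⁺ · e_k`. Assembly of the abstract `TateGraded.exists_basis_mem_filTensor_iff`
with §1; this is also Kato's «isomorphism preserving filtrations `V ⊗_{ℚ_p} B_dR ≅ D_dR(V) ⊗_K B_dR`» (LNM 1553,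
II §1.2.6, citing §1.1.3). [cite: Wach1996, §B.2.3, proof of Prop. 2 (p. 394)]
[cite: Kato1993LNM1553, Ch. II §1.2.6 (isomorphism preserving filtrations, §1.1.3)] [cite: FontaineAsterisque223III, Exp. III Thm. 1.5.2] -/
theorem exists_basis_mem_filTensor_iff_of_isDeRham [Algebra ℚ_[p] F]
    {M : Type} [AddCommGroup M] [Module ℚ_[p] M] [TopologicalSpace M] [Module.Finite ℚ_[p] M]
    (ρ : GaloisRep F ℚ_[p] M) (hρ : GaloisRep.IsDeRham (bdRPeriodRingData (F := F) (p := p) hp) ρ) :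
    ∃ (d : ℕ) (𝒷 : Module.Basis (Fin d) (bdRPeriodRingData (F := F) (p := p) hp).B
        ((bdRPeriodRingData (F := F) (p := p) hp).B ⊗[ℚ_[p]] M)) (w : Fin d → ℤ),
      (∀ k, 𝒷 k ∈ (bdRPeriodRingData (F := F) (p := p) hp).D ρ) ∧
      (∀ k, 𝒷 k ∈ (bdRPeriodRingData (F := F) (p := p) hp).filTensor M (w k)) ∧
      ∀ (n : ℤ) (x : (bdRPeriodRingData (F := F) (p := p) hp).B ⊗[ℚ_[p]] M),
        x ∈ (bdRPeriodRingData (F := F) (p := p) hp).filTensor M n ↔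
          ∀ k, 𝒷.repr x k ∈ (bdRPeriodRingData (F := F) (p := p) hp).fil (n - w k) := by
  have hF' : Function.Surjective (fontaineTheta (integerC F) p) := surjective_fontaineTheta_integerC hp
  haveI : IsDomain (BDeRhamPlus (integerC F) p) := isDomain_bDeRhamPlus hF'
  have hB : IsField (bdRPeriodRingData (F := F) (p := p) hp).B := Field.toIsField (FracBdR F p)
  exact TateGraded.exists_basis_mem_filTensor_iff (bdRPeriodRingData (F := F) (p := p) hp) ρ
    (U := algebraMap (BDeRhamPlus (integerC F) p) (FracBdR F p) uBdR)
    (χ := fun σ => LocalField.padicRingHom F p hp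
      (((GaloisRep.cyclotomicCharacter F p σ : ℤ_[p]ˣ) : ℤ_[p]) : ℚ_[p]))
    (fun i x => BdRTateGraded.mem_fil_succ_iff hp hF' i x)
    (fun σ => BdRTateGraded.exists_smul_unif hp hF' σ)
    (fun σ => BdRTateGraded.cyclotomic_ne_zero hp σ)
    (fun b hb hb1 => BdRTateGraded.exists_inv_of_not_mem_fil_one hp hF' hb hb1)
    (fun b hb hσ => BdRTateGraded.exists_sub_algebraMap_mem_fil_one hp hF' hb hσ)
    (fun j hj b hb hσ => BdRTateGraded.mem_fil_one_of_forall_twist hp hF' hj hb hσ)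
    hB hρ

end Literature.NumberTheory.PAdicHodge

end
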